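import Mathlib
import HarnessLib

/-!
# `NoHeavyLowerTail` (stmt-CriticalPhenomena-4575) — the CONVEXITY STEP of the `2+2` kernel: an affine function of the
# open-hair law of a two-port star, restricted to the hyperbola `h₁h₂ = u`, is bounded below by its two sure-hair
# corners and its formal ("both-or-nothing") corner

Support file (lemma factory `prim-lf-3` gen 7, seat g9; `--supports stmt-CriticalPhenomena-4575`).  No definitions, no named
facts, no sorries.  Memo: `run/shared/lean/prim/prim-lf-3/LF3-BETA-R.md` §2 (Step 1); lead memo `prim-nh-lead-4575/KERNEL-BETA-R-TORUS.md` (T3).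

A two-port star with hairs `h₁, h₂` touches exactly `{p₁}` with probability `a₁ = h₁ − u`, exactly `{p₂}` with `a₂ = h₂ − u`, both
with `u = h₁h₂`, none with `1 − u − a₁ − a₂`.  Every functional that is affine in the law, `F = c + d₁a₁ + d₂a₂` (`c` = its value at
the formal law `(∅ : 1−u, {p₁,p₂} : u)`), satisfies on the torus `h₁h₂ = u`, `h₁, h₂ ∈ [u,1]`:

  `hyperbola_affine_ge_min3`:  `F ≥ min (c, min (c + d₁(1−u), c + d₂(1−u)))`

(the last two are the sure-hair corners `h₁ = 1` and `h₂ = 1`).  Elementary: if `d₁, d₂ ≥ 0` then `F ≥ c`; if `d₂ ≤ 0` use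
`a₂ ≤ (1−u) − a₁·(1−u)/(1−u)`… precisely `u/h₁ − u ≤ 1 − h₁`, so `F ≥ λ(c + d₁(1−u)) + (1−λ)(c + d₂(1−u))` with `λ = (h₁−u)/(1−u)`;
symmetrically if `d₁ ≤ 0`.
-/

namespace Summit.CriticalPhenomena.PercolationContinuityZ3.Theorems

namespace UpsetExchange

/-- On the hyperbola: `u/h − u ≤ 1 − h` for `h ∈ [u, 1]`, `h > 0`. [folklore] -/
theorem hyperbola_coord_le {u h : ℝ} (hh0 : 0 < h) (huh : u ≤ h) (hh1 : h ≤ 1) :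
    u / h - u ≤ 1 - h := by
  rw [div_sub' (hc := ne_of_gt hh0), div_le_iff₀ hh0]
  nlinarith [mul_nonneg (sub_nonneg.2 huh) (sub_nonneg.2 hh1)]

/-- **Affine functionals on the hyperbola are bounded below by three corners.**  See the module docstring. [folklore] -/
theorem hyperbola_affine_ge_min3 {u h₁ h₂ c d₁ d₂ : ℝ} (hu0 : 0 ≤ u) (hu1 : u < 1)
    (h1pos : 0 < h₁) (h2pos : 0 < h₂) (h1le : h₁ ≤ 1) (h2le : h₂ ≤ 1) (hprod : h₁ * h₂ = u) :
    min c (min (c + d₁ * (1 - u)) (c + d₂ * (1 - u))) ≤ c + d₁ * (h₁ - u) + d₂ * (h₂ - u) := by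
  have hu1' : 0 < 1 - u := by linarith
  have huh1 : u ≤ h₁ := by nlinarith
  have huh2 : u ≤ h₂ := by nlinarith
  have ha1 : 0 ≤ h₁ - u := by linarith
  have ha2 : 0 ≤ h₂ - u := by linarith
  have hh2 : h₂ = u / h₁ := by rw [eq_div_iff (ne_of_gt h1pos)]; linarith
  have hh1 : h₁ = u / h₂ := by rw [eq_div_iff (ne_of_gt h2pos)]; linarith
  by_cases hd1 : 0 ≤ d₁
  · by_cases hd2 : 0 ≤ d₂
    · have : c ≤ c + d₁ * (h₁ - u) + d₂ * (h₂ - u) := by nlinarith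
      exact (min_le_left _ _).trans this
    · -- d₂ < 0: interpolate between the corners with λ = (h₁ - u)/(1 - u), using h₂ - u ≤ 1 - h₁
      have hd2' : d₂ ≤ 0 := le_of_lt (lt_of_not_ge hd2)
      have hcoord : h₂ - u ≤ 1 - h₁ := by rw [hh2]; exact hyperbola_coord_le h1pos huh1 h1le
      set lam : ℝ := (h₁ - u) / (1 - u) with hlam
      have hl0 : 0 ≤ lam := div_nonneg ha1 (le_of_lt hu1')
      have hl1 : lam ≤ 1 := by rw [hlam, div_le_one hu1']; linarith
      have e1 : d₁ * (h₁ - u) = lam * (d₁ * (1 - u)) := by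
        rw [hlam]; field_simp
      have e2 : (1 - lam) * (1 - u) = 1 - h₁ := by
        rw [hlam]; field_simp; ring
      have i2 : d₂ * (h₂ - u) ≥ (1 - lam) * (d₂ * (1 - u)) := by
        have : d₂ * (h₂ - u) ≥ d₂ * (1 - h₁) := by nlinarith
        calc (1 - lam) * (d₂ * (1 - u)) = d₂ * ((1 - lam) * (1 - u)) := by ring
          _ = d₂ * (1 - h₁) := by rw [e2]
          _ ≤ d₂ * (h₂ - u) := this
      have key : lam * (c + d₁ * (1 - u)) + (1 - lam) * (c + d₂ * (1 - u)) ≤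
          c + d₁ * (h₁ - u) + d₂ * (h₂ - u) := by nlinarith
      have hmin : min (c + d₁ * (1 - u)) (c + d₂ * (1 - u)) ≤
          lam * (c + d₁ * (1 - u)) + (1 - lam) * (c + d₂ * (1 - u)) := by
        have m1 := min_le_left (c + d₁ * (1 - u)) (c + d₂ * (1 - u))
        have m2 := min_le_right (c + d₁ * (1 - u)) (c + d₂ * (1 - u))
        nlinarith
      exact (min_le_right _ _).trans (hmin.trans key)
  · -- d₁ < 0: symmetric, λ' = (h₂ - u)/(1 - u), h₁ - u ≤ 1 - h₂
    have hd1' : d₁ ≤ 0 := le_of_lt (lt_of_not_ge hd1)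
    have hcoord : h₁ - u ≤ 1 - h₂ := by rw [hh1]; exact hyperbola_coord_le h2pos huh2 h2le
    set lam : ℝ := (h₂ - u) / (1 - u) with hlam
    have hl0 : 0 ≤ lam := div_nonneg ha2 (le_of_lt hu1')
    have hl1 : lam ≤ 1 := by rw [hlam, div_le_one hu1']; linarith
    have e1 : d₂ * (h₂ - u) = lam * (d₂ * (1 - u)) := by
      rw [hlam]; field_simp
    have e2 : (1 - lam) * (1 - u) = 1 - h₂ := by
      rw [hlam]; field_simp; ring
    have i2 : d₁ * (h₁ - u) ≥ (1 - lam) * (d₁ * (1 - u)) := by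
      have : d₁ * (h₁ - u) ≥ d₁ * (1 - h₂) := by nlinarith
      calc (1 - lam) * (d₁ * (1 - u)) = d₁ * ((1 - lam) * (1 - u)) := by ring
        _ = d₁ * (1 - h₂) := by rw [e2]
        _ ≤ d₁ * (h₁ - u) := this
    have key : (1 - lam) * (c + d₁ * (1 - u)) + lam * (c + d₂ * (1 - u)) ≤
        c + d₁ * (h₁ - u) + d₂ * (h₂ - u) := by nlinarith
    have hmin : min (c + d₁ * (1 - u)) (c + d₂ * (1 - u)) ≤
        (1 - lam) * (c + d₁ * (1 - u)) + lam * (c + d₂ * (1 - u)) := by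
      have m1 := min_le_left (c + d₁ * (1 - u)) (c + d₂ * (1 - u))
      have m2 := min_le_right (c + d₁ * (1 - u)) (c + d₂ * (1 - u))
      nlinarith
    exact (min_le_right _ _).trans (hmin.trans key)

end UpsetExchange

end Summit.CriticalPhenomena.PercolationContinuityZ3.Theorems
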